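import Summits.CriticalPhenomena.PercolationContinuityZ3.Theorems.Transplant.Slab111SKBits
import Summits.CriticalPhenomena.PercolationContinuityZ3.Theorems.Transplant.Slab111VModel
import HarnessLib

/-!
# Small thickness `(111)`-films, III: the bitboard INDICES AS FILM VERTICES

builds on p205010 (kernel theorem, internal audit signed; external expert review pending) — NOT used in this file.  Lane `prim-bschramm`, seat
`prim-bschramm-p2` (gen 38; class C1b; memo `HOME/bschramm/P2-LATTICES.md` §136); helper file (`--supports stmt-CriticalPhenomena-4575 --as helper`).
The dictionary between the kernel checker «Slab111SKDefs» and the film `F_k`: an index `i = 100·L + 10·(a+5) + (b+5)` of a case context `C`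
(thickness `C.k`, class `C.c0 = cls z`) is the film vertex `vtx C.k z i = toV k ((z₀ + a, z₁ + b), L)` («Slab111VModel»).
* §1 digits, validity (`validB_iff`), admissibility (`madm_of_valid`), shadow and level of `vtx`, injectivity;
* §2 adjacency: `AdjRel` of valid indices is a film edge (`adj_vtx`) and conversely (`adjRel_of_adj`); every film vertex over `hexBall z 4` has an
  index (`exists_idx`), in particular every neighbour of a vertex over `hexBall z 3` (`exists_idx_of_adj`);
* §3 reading the block / window / centre / column tests (`inRB_iff_mem_blkR`, `inWinB_of_inWin`, `cenB_iff`, `testBit_colM_iff`, `forcedB_of_mem`).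
[cite: DuminilCopinSidoraviciusTassion2016, §2.3 (proof of Fact 2: the ball B_R(z))]
-/

noncomputable section

namespace Summit.CriticalPhenomena.PercolationContinuityZ3.Theorems.Transplant

open Literature.Probability.Percolation Literature.Probability.LatticeModels SimpleGraph
open scoped Classical

namespace Slab111.SK

/-! ## §1 Digits, validity, the vertex of an index -/

/-- An index is determined by its three digits. [folklore] -/
theorem digits_eq (i : ℕ) : i = 100 * dL i + 10 * dA i + dB i := by
  unfold dL dA dB; omega

/-- The column code in digits. [folklore] -/
theorem mod_digits (i : ℕ) : i % 100 = 10 * dA i + dB i ∧ dB i < 10 ∧ dA i < 10 := by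
  unfold dA dB; omega

/-- Reading `validB`. [folklore] -/
theorem validB_iff (C : Ctx) (i : ℕ) : C.validB i = true ↔ i < 1000 ∧ 1 ≤ dA i ∧ dA i ≤ 9 ∧ 1 ≤ dB i ∧ dB i ≤ 9 ∧ 6 ≤ dA i + dB i ∧
    dA i + dB i ≤ 14 ∧ dL i ≤ C.k ∧ dL i % 3 = (C.c0 + dA i + 2 * dB i) % 3 := by
  simp only [Ctx.validB, Bool.and_eq_true, decide_eq_true_eq, beq_iff_eq, and_assoc]

/-- **The class hypothesis on the block centre**: `z₀ + 2 z₁ ≡ c₀ (mod 3)` (i.e. `C.c0 = cls z`). [folklore] -/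
def ClassHyp (C : Ctx) (z : Site 2) : Prop := (3 : ℤ) ∣ z 0 + 2 * z 1 - (C.c0 : ℤ)

/-- The relative model vertex of an index: column `z + (a, b)`, level `L`. [folklore] -/
def relMV (z : Site 2) (i : ℕ) : MV := ((z 0 + ((dA i : ℤ) - 5), z 1 + ((dB i : ℤ) - 5)), (dL i : ℤ))

/-- **The film vertex of an index.** [folklore] -/
def vtx (k : ℕ) (z : Site 2) (i : ℕ) : slab111 k := toV k (relMV z i)

variable {C : Ctx} {z : Site 2}

/-- A valid index is an admissible model vertex. [folklore] -/
theorem madm_of_valid (hz : ClassHyp C z) {i : ℕ} (hv : C.validB i = true) : MAdm C.k (relMV z i) := by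
  rw [validB_iff] at hv
  obtain ⟨-, -, -, -, -, -, -, hk, hmod⟩ := hv
  unfold ClassHyp at hz
  refine ⟨?_, ?_, ?_⟩
  · simp only [relMV]
    omega
  · simp only [relMV]; omega
  · simp only [relMV]; omega

/-- The shadow of the vertex of a valid index. [folklore] -/
theorem sh_vtx (hz : ClassHyp C z) {i : ℕ} (hv : C.validB i = true) :
    sh (vtx C.k z i) = ![z 0 + ((dA i : ℤ) - 5), z 1 + ((dB i : ℤ) - 5)] := by
  rw [vtx, sh_toV (madm_of_valid hz hv)]; rfl

/-- Coordinates of the shadow. [folklore] -/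
theorem sh_vtx_zero (hz : ClassHyp C z) {i : ℕ} (hv : C.validB i = true) : sh (vtx C.k z i) 0 = z 0 + ((dA i : ℤ) - 5) := by
  rw [sh_vtx hz hv]; rfl

/-- Coordinates of the shadow. [folklore] -/
theorem sh_vtx_one (hz : ClassHyp C z) {i : ℕ} (hv : C.validB i = true) : sh (vtx C.k z i) 1 = z 1 + ((dB i : ℤ) - 5) := by
  rw [sh_vtx hz hv]; rfl

/-- The level of the vertex of a valid index. [folklore] -/
theorem lev_vtx (hz : ClassHyp C z) {i : ℕ} (hv : C.validB i = true) : lev ((vtx C.k z i : slab111 C.k) : Site 3) = dL i := by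
  rw [vtx, lev_toV (madm_of_valid hz hv)]; rfl

/-- **`vtx` is injective on valid indices.** [folklore] -/
theorem vtx_inj (hz : ClassHyp C z) {i j : ℕ} (hi : C.validB i = true) (hj : C.validB j = true) (h : vtx C.k z i = vtx C.k z j) : i = j := by
  have := toV_inj (madm_of_valid hz hi) (madm_of_valid hz hj) h
  simp only [relMV, Prod.mk.injEq] at this
  obtain ⟨⟨h1, h2⟩, h3⟩ := this
  rw [digits_eq i, digits_eq j]; omega

/-! ## §2 Adjacency and indexing of film vertices -/

/-- One step in digits: one level up along an up-direction, or the reverse. [folklore] -/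
def DigitStep (i j : ℕ) : Prop :=
  (dL j = dL i + 1 ∧ ((dA j = dA i + 1 ∧ dB j = dB i) ∨ (dA j = dA i ∧ dB j + 1 = dB i) ∨ (dA j + 1 = dA i ∧ dB j = dB i + 1))) ∨
    (dL i = dL j + 1 ∧ ((dA i = dA j + 1 ∧ dB i = dB j) ∨ (dA i = dA j ∧ dB i + 1 = dB j) ∨ (dA i + 1 = dA j ∧ dB i = dB j + 1)))

/-- `AdjRel` of indices with column digits in `[1, 9]` is a digit step. [folklore] -/
theorem digitStep_of_adjRel {i j : ℕ} (hi : 1 ≤ dA i ∧ dA i ≤ 9 ∧ 1 ≤ dB i ∧ dB i ≤ 9) (hj : 1 ≤ dA j ∧ dA j ≤ 9 ∧ 1 ≤ dB j ∧ dB j ≤ 9)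
    (h : AdjRel i j) : DigitStep i j := by
  have ei := digits_eq i; have ej := digits_eq j
  unfold DigitStep
  rcases h with h | h | h | h | h | h
  · exact Or.inl ⟨by omega, Or.inl ⟨by omega, by omega⟩⟩
  · exact Or.inl ⟨by omega, Or.inr (Or.inl ⟨by omega, by omega⟩)⟩
  · exact Or.inl ⟨by omega, Or.inr (Or.inr ⟨by omega, by omega⟩)⟩
  · exact Or.inr ⟨by omega, Or.inl ⟨by omega, by omega⟩⟩
  · exact Or.inr ⟨by omega, Or.inr (Or.inl ⟨by omega, by omega⟩)⟩
  · exact Or.inr ⟨by omega, Or.inr (Or.inr ⟨by omega, by omega⟩)⟩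

/-- A digit step is `AdjRel`. [folklore] -/
theorem adjRel_of_digitStep {i j : ℕ} (h : DigitStep i j) : AdjRel i j := by
  have ei := digits_eq i; have ej := digits_eq j
  unfold AdjRel
  rcases h with ⟨hl, ⟨h1, h2⟩ | ⟨h1, h2⟩ | ⟨h1, h2⟩⟩ | ⟨hl, ⟨h1, h2⟩ | ⟨h1, h2⟩ | ⟨h1, h2⟩⟩
  · exact Or.inl (by omega)
  · exact Or.inr (Or.inl (by omega))
  · exact Or.inr (Or.inr (Or.inl (by omega)))
  · exact Or.inr (Or.inr (Or.inr (Or.inl (by omega))))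
  · exact Or.inr (Or.inr (Or.inr (Or.inr (Or.inl (by omega)))))
  · exact Or.inr (Or.inr (Or.inr (Or.inr (Or.inr (by omega)))))

/-- Column digit ranges of a valid index. [folklore] -/
theorem ranges_of_valid {C : Ctx} {i : ℕ} (hv : C.validB i = true) : 1 ≤ dA i ∧ dA i ≤ 9 ∧ 1 ≤ dB i ∧ dB i ≤ 9 := by
  have h := (validB_iff C i).1 hv
  exact ⟨h.2.1, h.2.2.1, h.2.2.2.1, h.2.2.2.2.1⟩

/-- **Adjacent valid indices are adjacent film vertices.** [folklore] -/
theorem adj_vtx (hz : ClassHyp C z) {i j : ℕ} (hi : C.validB i = true) (hj : C.validB j = true) (h : AdjRel i j) :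
    (film C.k).Adj (vtx C.k z i) (vtx C.k z j) := by
  refine adj_toV_of_mstep (madm_of_valid hz hi) (madm_of_valid hz hj) ?_
  have hd := digitStep_of_adjRel (ranges_of_valid hi) (ranges_of_valid hj) h
  simp only [MStep, relMV]
  rcases hd with ⟨hl, ⟨h1, h2⟩ | ⟨h1, h2⟩ | ⟨h1, h2⟩⟩ | ⟨hl, ⟨h1, h2⟩ | ⟨h1, h2⟩ | ⟨h1, h2⟩⟩
  · exact Or.inl ⟨by omega, Or.inl ⟨by omega, by omega⟩⟩
  · exact Or.inl ⟨by omega, Or.inr (Or.inl ⟨by omega, by omega⟩)⟩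
  · exact Or.inl ⟨by omega, Or.inr (Or.inr ⟨by omega, by omega⟩)⟩
  · exact Or.inr ⟨by omega, Or.inl ⟨by omega, by omega⟩⟩
  · exact Or.inr ⟨by omega, Or.inr (Or.inl ⟨by omega, by omega⟩)⟩
  · exact Or.inr ⟨by omega, Or.inr (Or.inr ⟨by omega, by omega⟩)⟩

/-- The shadow/level change along a film edge: one level up along an up-direction, or the reverse. [folklore] -/
theorem sh_lev_of_adj {k : ℕ} {x y : slab111 k} (h : (film k).Adj x y) :
    (lev (y : Site 3) = lev (x : Site 3) + 1 ∧
        ((sh y 0 = sh x 0 + 1 ∧ sh y 1 = sh x 1) ∨ (sh y 0 = sh x 0 ∧ sh y 1 = sh x 1 - 1) ∨ (sh y 0 = sh x 0 - 1 ∧ sh y 1 = sh x 1 + 1))) ∨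
      (lev (x : Site 3) = lev (y : Site 3) + 1 ∧
        ((sh x 0 = sh y 0 + 1 ∧ sh x 1 = sh y 1) ∨ (sh x 0 = sh y 0 ∧ sh x 1 = sh y 1 - 1) ∨ (sh x 0 = sh y 0 - 1 ∧ sh x 1 = sh y 1 + 1))) := by
  have hadj : (zdGraph 3).Adj (x : Site 3) (y : Site 3) := h
  obtain ⟨i, hi | hi⟩ := (zdGraph_adj_iff _ _).1 hadj
  · left
    have h0 := congrFun hi 0; have h1 := congrFun hi 1; have h2 := congrFun hi 2
    simp only [lev, sh_apply_zero, sh_apply_one]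
    fin_cases i <;> simp at h0 h1 h2 <;> omega
  · right
    have h0 := congrFun hi 0; have h1 := congrFun hi 1; have h2 := congrFun hi 2
    simp only [lev, sh_apply_zero, sh_apply_one]
    fin_cases i <;> simp at h0 h1 h2 <;> omega

/-- **Adjacent vertices of valid indices have adjacent indices.** [folklore] -/
theorem adjRel_of_adj (hz : ClassHyp C z) {i j : ℕ} (hi : C.validB i = true) (hj : C.validB j = true)
    (h : (film C.k).Adj (vtx C.k z i) (vtx C.k z j)) : AdjRel i j := by
  have H := sh_lev_of_adj h
  rw [lev_vtx hz hi, lev_vtx hz hj, sh_vtx_zero hz hi, sh_vtx_zero hz hj, sh_vtx_one hz hi, sh_vtx_one hz hj] at H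
  apply adjRel_of_digitStep
  unfold DigitStep
  rcases H with ⟨hl, ⟨h1, h2⟩ | ⟨h1, h2⟩ | ⟨h1, h2⟩⟩ | ⟨hl, ⟨h1, h2⟩ | ⟨h1, h2⟩ | ⟨h1, h2⟩⟩
  · exact Or.inl ⟨by omega, Or.inl ⟨by omega, by omega⟩⟩
  · exact Or.inl ⟨by omega, Or.inr (Or.inl ⟨by omega, by omega⟩)⟩
  · exact Or.inl ⟨by omega, Or.inr (Or.inr ⟨by omega, by omega⟩)⟩
  · exact Or.inr ⟨by omega, Or.inl ⟨by omega, by omega⟩⟩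
  · exact Or.inr ⟨by omega, Or.inr (Or.inl ⟨by omega, by omega⟩)⟩
  · exact Or.inr ⟨by omega, Or.inr (Or.inr ⟨by omega, by omega⟩)⟩

/-- **Every film vertex over `hexBall z 4` has a valid index.** [folklore] -/
theorem exists_idx (hz : ClassHyp C z) (hk : C.k ≤ 9) (x : slab111 C.k) (hx : triNorm (sh x - z) ≤ 4) :
    ∃ i, C.validB i = true ∧ vtx C.k z i = x := by
  obtain ⟨hadm, hxeq⟩ := exists_eq_vl x
  obtain ⟨⟨c, hc⟩, h0, hk'⟩ := hadm
  simp only [lvl] at hc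
  simp only [triNorm, Pi.sub_apply, max_le_iff, abs_le] at hx
  obtain ⟨⟨ha1, ha2⟩, ⟨hb1, hb2⟩, hab1, hab2⟩ := hx
  obtain ⟨L, hL⟩ := Int.eq_ofNat_of_zero_le h0
  obtain ⟨A, hA⟩ := Int.eq_ofNat_of_zero_le (show (0 : ℤ) ≤ sh x 0 - z 0 + 5 by omega)
  obtain ⟨B, hB⟩ := Int.eq_ofNat_of_zero_le (show (0 : ℤ) ≤ sh x 1 - z 1 + 5 by omega)
  unfold ClassHyp at hz
  refine ⟨100 * L + 10 * A + B, ?_, ?_⟩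
  · rw [validB_iff]
    have hdL : dL (100 * L + 10 * A + B) = L := by unfold dL; omega
    have hdA : dA (100 * L + 10 * A + B) = A := by unfold dA; omega
    have hdB : dB (100 * L + 10 * A + B) = B := by unfold dB; omega
    rw [hdL, hdA, hdB]
    refine ⟨by omega, by omega, by omega, by omega, by omega, by omega, by omega, by omega, ?_⟩
    omega
  · rw [hxeq, vtx, toV]
    have hdL : dL (100 * L + 10 * A + B) = L := by unfold dL; omega
    have hdA : dA (100 * L + 10 * A + B) = A := by unfold dA; omega
    have hdB : dB (100 * L + 10 * A + B) = B := by unfold dB; omega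
    have hq : mcol (relMV z (100 * L + 10 * A + B)) = sh x := by
      ext t; fin_cases t
      · show z 0 + ((dA (100 * L + 10 * A + B) : ℤ) - 5) = sh x 0
        rw [hdA]; omega
      · show z 1 + ((dB (100 * L + 10 * A + B) : ℤ) - 5) = sh x 1
        rw [hdB]; omega
    have hl : (relMV z (100 * L + 10 * A + B)).2 = lev (x : Site 3) := by
      show ((dL (100 * L + 10 * A + B) : ℕ) : ℤ) = lev (x : Site 3)
      rw [hdL]; omega
    rw [hq, hl]

/-- A unit step keeps the shadow within one more ring. [folklore] -/
theorem triNorm_le_succ_of_adj {k : ℕ} {x y : slab111 k} {z : Site 2} {n : ℤ} (hx : triNorm (sh x - z) ≤ n) (h : (film k).Adj x y) :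
    triNorm (sh y - z) ≤ n + 1 := by
  have H := sh_lev_of_adj h
  simp only [triNorm, Pi.sub_apply, max_le_iff, abs_le] at hx ⊢
  omega

/-- **A neighbour of the vertex of a rerouting-block index has a valid index, adjacent in `AdjRel`.** [folklore] -/
theorem exists_idx_of_adj (hz : ClassHyp C z) (hk : C.k ≤ 9) {i : ℕ} (hi : C.validB i = true) (h3 : triNorm (sh (vtx C.k z i) - z) ≤ 3)
    {y : slab111 C.k} (h : (film C.k).Adj (vtx C.k z i) y) : ∃ j, C.validB j = true ∧ vtx C.k z j = y ∧ AdjRel i j := by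
  obtain ⟨j, hj, rfl⟩ := exists_idx hz hk y (by have := triNorm_le_succ_of_adj h3 h; omega)
  exact ⟨j, hj, rfl, adjRel_of_adj hz hi hj h⟩

/-! ## §3 Reading the block, window, centre and column tests -/

/-- The shadow of a valid index relative to the centre, in digits. [folklore] -/
theorem triNorm_vtx_le_iff (hz : ClassHyp C z) {i : ℕ} (hv : C.validB i = true) (n : ℕ) :
    triNorm (sh (vtx C.k z i) - z) ≤ n ↔ dA i ≤ n + 5 ∧ 5 ≤ dA i + n ∧ dB i ≤ n + 5 ∧ 5 ≤ dB i + n ∧ dA i + dB i ≤ n + 10 ∧ 10 ≤ dA i + dB i + n := by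
  rw [sh_vtx hz hv]
  simp only [triNorm, Pi.sub_apply, Matrix.cons_val_zero, Matrix.cons_val_one, max_le_iff, abs_le]
  omega

/-- **The rerouting-block test reads membership in `blkR 3 z tR sR`.** [folklore] -/
theorem inRB_iff_mem_blkR (hz : ClassHyp C z) {i : ℕ} (hv : C.validB i = true) {tR sR : ℕ} (htR : C.tR = min tR 3) (hsR : C.sR = min sR 3) :
    C.inRB i = true ↔ sh (vtx C.k z i) ∈ blkR 3 z tR sR := by
  rw [mem_blkR, mem_hexBall, show ((3 : ℕ) : ℤ) = ((3 : ℕ) : ℤ) from rfl, triNorm_vtx_le_iff hz hv 3, sh_vtx_zero hz hv, sh_vtx_one hz hv]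
  simp only [Ctx.inRB, hv, Bool.true_and, Bool.and_eq_true, decide_eq_true_eq, htR, hsR]
  omega

/-- Membership in the cleared block `blkR 3 z tD sD` from the digit test used for the allowed mask. [folklore] -/
theorem mem_blkR_of_digits (hz : ClassHyp C z) {i : ℕ} (hv : C.validB i = true) {tD sD t1 s1 : ℕ} (ht : t1 ≤ tD) (hs : s1 ≤ sD)
    (h : 2 ≤ dA i ∧ dA i ≤ 8 ∧ 2 ≤ dB i ∧ dB i ≤ 8 ∧ 7 ≤ dA i + dB i ∧ dA i + dB i ≤ 13 ∧ dA i ≤ t1 + 5 ∧ dA i + dB i ≤ s1 + 10) :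
    sh (vtx C.k z i) ∈ blkR 3 z tD sD := by
  rw [mem_blkR, mem_hexBall, show ((3 : ℕ) : ℤ) = ((3 : ℕ) : ℤ) from rfl, triNorm_vtx_le_iff hz hv 3, sh_vtx_zero hz hv, sh_vtx_one hz hv]
  omega

/-- Reading membership in `hexBall z 1 ∩ blkR 3 z tD sD` into digits (for the forced mask). [folklore] -/
theorem digits_of_mem_hexBall_one (hz : ClassHyp C z) {i : ℕ} (hv : C.validB i = true) {tD sD : ℕ} (h1 : sh (vtx C.k z i) ∈ hexBall z 1)
    (hD : sh (vtx C.k z i) ∈ blkR 3 z tD sD) :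
    4 ≤ dA i ∧ dA i ≤ 6 ∧ 4 ≤ dB i ∧ dB i ≤ 6 ∧ 9 ≤ dA i + dB i ∧ dA i + dB i ≤ 11 ∧ dA i ≤ tD + 5 ∧ dA i + dB i ≤ sD + 10 := by
  rw [mem_hexBall, show ((1 : ℕ) : ℤ) = ((1 : ℕ) : ℤ) from rfl, triNorm_vtx_le_iff hz hv 1] at h1
  rw [mem_blkR, sh_vtx_zero hz hv, sh_vtx_one hz hv] at hD
  omega

/-- **The window test from the real window** (case bounds at least the node's, or unconstrained). [folklore] -/
theorem inWinB_of_inWin (hz : ClassHyp C z) {i : ℕ} (hv : C.validB i = true) {tD sR : ℕ} (hwT : tD ≤ C.wT ∨ 4 ≤ C.wT) (hwS : sR ≤ C.wS ∨ 4 ≤ C.wS)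
    (h : HexShadow.InWin z tD sR (sh (vtx C.k z i))) : C.inWinB i = true := by
  unfold HexShadow.InWin at h
  rw [sh_vtx_zero hz hv, sh_vtx_one hz hv] at h
  have hv' := (validB_iff C i).1 hv
  simp only [Ctx.inWinB, hv, Bool.true_and, Bool.and_eq_true, decide_eq_true_eq]
  omega

/-- **The centre test reads "over `z`".** [folklore] -/
theorem cenB_iff (hz : ClassHyp C z) {i : ℕ} (hv : C.validB i = true) : C.cenB i = true ↔ sh (vtx C.k z i) = z := by
  simp only [Ctx.cenB, hv, Bool.true_and, Bool.and_eq_true, beq_iff_eq]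
  rw [sh_vtx hz hv]
  constructor
  · rintro ⟨ha, hb⟩; ext t; fin_cases t <;> simp [ha, hb]
  · intro h
    have h0 := congrFun h 0; have h1 := congrFun h 1
    simp at h0 h1; omega

/-- Two valid indices lie over the same column iff their column codes agree. [folklore] -/
theorem sh_eq_iff_mod (hz : ClassHyp C z) {i j : ℕ} (hi : C.validB i = true) (hj : C.validB j = true) :
    sh (vtx C.k z i) = sh (vtx C.k z j) ↔ i % 100 = j % 100 := by
  rw [sh_vtx hz hi, sh_vtx hz hj]
  have ei := digits_eq i; have ej := digits_eq j
  have hi' := (validB_iff C i).1 hi; have hj' := (validB_iff C j).1 hj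
  have mi := mod_digits i; have mj := mod_digits j
  constructor
  · intro h
    have h0 := congrFun h 0; have h1 := congrFun h 1
    simp at h0 h1
    omega
  · intro h
    have hA : dA i = dA j := by omega
    have hB : dB i = dB j := by omega
    rw [hA, hB]

/-- Bits of `colSlots`: the ten level slots. [folklore] -/
theorem testBit_colSlots (n : ℕ) : colSlots.testBit n = true ↔ ∃ L, L ≤ 9 ∧ n = 100 * L := by
  rw [colSlots, testBit_foldl_or]
  simp only [Nat.zero_testBit, Bool.false_eq_true, false_or, testBit_bitOf, decide_eq_true_eq, List.mem_cons, List.not_mem_nil, or_false]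
  constructor
  · rintro ⟨L, hL, h⟩
    refine ⟨L, ?_, h.symm⟩
    rcases hL with rfl | rfl | rfl | rfl | rfl | rfl | rfl | rfl | rfl | rfl <;> omega
  · rintro ⟨L, hL, rfl⟩
    refine ⟨L, ?_, rfl⟩
    interval_cases L <;> simp

/-- **Bits of a column mask**: the valid indices with the same column code. [folklore] -/
theorem testBit_colM_iff (C : Ctx) (e i : ℕ) : (C.colM e).testBit i = true ↔ C.validB i = true ∧ i % 100 = e % 100 := by
  unfold Ctx.colM
  rw [Nat.testBit_land, Bool.and_eq_true, Nat.testBit_shiftLeft, Bool.and_eq_true, decide_eq_true_eq, testBit_colSlots, Ctx.univ,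
    testBit_maskBelow, Bool.and_eq_true, decide_eq_true_eq]
  constructor
  · rintro ⟨⟨hle, L, hL, hn⟩, hi, hv⟩
    exact ⟨hv, by omega⟩
  · rintro ⟨hv, hmod⟩
    have hi := ((validB_iff C i).1 hv).1
    refine ⟨⟨by omega, i / 100, by omega, by omega⟩, hi, hv⟩

/-- Column mask membership reads equality of shadows. [folklore] -/
theorem testBit_colM_iff_sh (hz : ClassHyp C z) {e i : ℕ} (he : C.validB e = true) (hi : C.validB i = true) :
    (C.colM e).testBit i = true ↔ sh (vtx C.k z i) = sh (vtx C.k z e) := by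
  rw [testBit_colM_iff, sh_eq_iff_mod hz hi he]
  exact ⟨fun h => h.2, fun h => ⟨hi, h⟩⟩

/-- Universe bits are the valid indices. [folklore] -/
theorem testBit_univ_iff (C : Ctx) (i : ℕ) : C.univ.testBit i = true ↔ C.validB i = true := by
  rw [Ctx.univ, testBit_maskBelow, Bool.and_eq_true, decide_eq_true_eq]
  exact ⟨fun h => h.2, fun h => ⟨((validB_iff C i).1 h).1, h⟩⟩

/-- Rerouting-mask bits. [folklore] -/
theorem testBit_WR_iff (C : Ctx) (i : ℕ) : C.WR.testBit i = true ↔ C.W.testBit i = true ∧ C.inRB i = true := by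
  rw [Ctx.WR, Nat.testBit_land, Bool.and_eq_true, testBit_maskBelow, Bool.and_eq_true, decide_eq_true_eq]
  constructor
  · rintro ⟨hW, -, hR⟩; exact ⟨hW, hR⟩
  · rintro ⟨hW, hR⟩
    have hv : C.validB i = true := by simp only [Ctx.inRB, Bool.and_eq_true] at hR; exact hR.1.1.1.1.1.1.1.1
    exact ⟨hW, ((validB_iff C i).1 hv).1, hR⟩

/-- Window-mask bits. [folklore] -/
theorem testBit_win_iff (C : Ctx) (i : ℕ) : C.win.testBit i = true ↔ C.inWinB i = true := by
  rw [Ctx.win, testBit_maskBelow, Bool.and_eq_true, decide_eq_true_eq]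
  constructor
  · rintro ⟨-, h⟩; exact h
  · intro h
    have hv : C.validB i = true := by simp only [Ctx.inWinB, Bool.and_eq_true] at h; exact h.1.1
    exact ⟨((validB_iff C i).1 hv).1, h⟩

/-- Centre-mask bits. [folklore] -/
theorem testBit_cen_iff (C : Ctx) (i : ℕ) : C.cen.testBit i = true ↔ C.cenB i = true := by
  rw [Ctx.cen, testBit_maskBelow, Bool.and_eq_true, decide_eq_true_eq]
  constructor
  · rintro ⟨-, h⟩; exact h
  · intro h
    have hv : C.validB i = true := by simp only [Ctx.cenB, Bool.and_eq_true] at h; exact h.1.1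
    exact ⟨((validB_iff C i).1 hv).1, h⟩

/-- `inRB` implies validity. [folklore] -/
theorem validB_of_inRB {C : Ctx} {i : ℕ} (h : C.inRB i = true) : C.validB i = true := by
  simp only [Ctx.inRB, Bool.and_eq_true] at h; exact h.1.1.1.1.1.1.1.1

/-- `inRB` implies the radius-`3` digit bounds. [folklore] -/
theorem triNorm_le_three_of_inRB (hz : ClassHyp C z) {i : ℕ} (h : C.inRB i = true) : triNorm (sh (vtx C.k z i) - z) ≤ 3 := by
  have hv := validB_of_inRB h
  rw [show (3 : ℤ) = ((3 : ℕ) : ℤ) from rfl, triNorm_vtx_le_iff hz hv 3]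
  simp only [Ctx.inRB, Bool.and_eq_true, decide_eq_true_eq] at h
  omega

end Slab111.SK

end Summit.CriticalPhenomena.PercolationContinuityZ3.Theorems.Transplant

end
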